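import Literature.Probability.Percolation.SlabCircuitTheorem310Holds
import HarnessLib

/-!
# Newman–Tassion–Wu 2017, Theorem 3.10 — the form with a threshold uniform in the thickness

Topic: `Literature/Probability/Percolation`. Addendum to the port of THEOREM 3.10 of Newman–Tassion–Wu,
*Critical percolation and the minimal spanning tree in slabs* (CPAM 70 (2017); arXiv:1512.09107):
`h310_holds` (`SlabCircuitTheorem310Holds.lean`) asks `m₀ ≥ max 52 (k+1)` because the small-parameter
bound `hl_smallP` used `ε₀ = 1/12` with `n₀ = k + 1`. Taking `ε₀ = 1/(12(k+1))` instead makes the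
path count work from `n₀ = 1` (`hl_smallP_uniform`), so THEOREM 3.10 holds in the form `h310` for
every `m₀ ≥ 52`, the same threshold for all `k` (`h310_holds_uniform`) — the form in which the
assembly `Crossing.NewmanTassionWu2017_thm31_of_four` (one `m₀` for all `k`) consumes it.

## Sources

* C. M. Newman, V. Tassion, W. Wu, *Critical percolation and the minimal spanning tree in slabs*,
  Comm. Pure Appl. Math. 70 (2017), arXiv:1512.09107: Theorem 3.10 and (3.34) [NewmanTassionWu2017].
-/

noncomputable section

namespace Literature.Probability.Percolation

open MeasureTheory LatticeModels SimpleGraph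

namespace NTW17

variable {k : ℕ}

/-- **(HL) with a threshold uniform in `k`**: for `p ≤ 1/(12(k+1))` and every `n ≥ 1`,
`f_p(2n, n-1) ≤ n(k+1)(6p)^{2n} ≤ n·4^{-n}/(k+1) ≤ 1/2`. [cite: NewmanTassionWu2017, Theorem 3.10 (proof, (3.34))] -/
theorem hl_smallP_uniform (k : ℕ) :
    ∀ n : ℕ, 1 ≤ n → ∀ p : unitInterval, (p : ℝ) ≤ 1 / (12 * ((k : ℝ) + 1)) →
      crossingProb k p (2 * n) (n - 1) ≤ 1 / 2 := by
  intro n hn p hp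
  have h1 := crossingProb_le_card_mul_pow (k := k) p (2 * n) (n - 1)
  have hn1 : ((n - 1 : ℕ) : ℝ) + 1 = n := by rw [Nat.cast_sub (by omega)]; ring
  rw [hn1] at h1
  have hp0 : 0 ≤ (p : ℝ) := p.2.1
  have hk0 : (0 : ℝ) < (k : ℝ) + 1 := by positivity
  have h6p : 6 * (p : ℝ) ≤ 1 / (2 * ((k : ℝ) + 1)) := by
    rw [le_div_iff₀ (by positivity)] at hp ⊢; nlinarith
  have h6p0 : 0 ≤ 6 * (p : ℝ) := by linarith
  have hpow : (6 * (p : ℝ)) ^ (2 * n) ≤ (1 / (2 * ((k : ℝ) + 1))) ^ (2 * n) :=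
    pow_le_pow_left₀ h6p0 h6p _
  -- the integer inequality `2n(k+1) ≤ (2(k+1))^{2n}`
  have hnat : 2 * n * (k + 1) ≤ (2 * (k + 1)) ^ (2 * n) := by
    have h2n : 2 * n ≤ 4 ^ n := by
      have := Nat.lt_two_pow_self (n := n)
      have h22 : 2 * 2 ^ n ≤ 4 ^ n := by
        rw [show (4 : ℕ) = 2 ^ 2 by norm_num, ← pow_mul]
        calc 2 * 2 ^ n = 2 ^ (n + 1) := by ring
          _ ≤ 2 ^ (2 * n) := Nat.pow_le_pow_right (by norm_num) (by omega)
      omega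
    have hk1 : k + 1 ≤ (k + 1) ^ (2 * n) := Nat.le_self_pow (by omega) _
    calc 2 * n * (k + 1) ≤ 4 ^ n * (k + 1) ^ (2 * n) := Nat.mul_le_mul h2n hk1
      _ = (2 * (k + 1)) ^ (2 * n) := by
          rw [mul_pow, show (4 : ℕ) = 2 ^ 2 by norm_num, ← pow_mul]
  have hreal : (2 : ℝ) * n * ((k : ℝ) + 1) ≤ (2 * ((k : ℝ) + 1)) ^ (2 * n) := by exact_mod_cast hnat
  have hpos : (0 : ℝ) < (2 * ((k : ℝ) + 1)) ^ (2 * n) := by positivity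
  calc crossingProb k p (2 * n) (n - 1) ≤ n * (k + 1) * (6 * (p : ℝ)) ^ (2 * n) := h1
    _ ≤ n * (k + 1) * (1 / (2 * ((k : ℝ) + 1))) ^ (2 * n) :=
        mul_le_mul_of_nonneg_left hpow (by positivity)
    _ = n * (k + 1) / (2 * ((k : ℝ) + 1)) ^ (2 * n) := by rw [one_div_pow]; ring
    _ ≤ 1 / 2 := by
        rw [div_le_iff₀ hpos]
        linarith

/-- **NTW 2017, THEOREM 3.10 with one threshold for all thicknesses**: the form `h310` of
`Crossing.NewmanTassionWu2017_thm31_of_four` for every `m₀ ≥ 52`. [cite: NewmanTassionWu2017, Theorem 3.10] -/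
theorem h310_holds_uniform (hk : 1 ≤ k) {m₀ : ℕ} (hm₀ : 52 ≤ m₀) :
    ∀ ε : ℝ, 0 < ε → ∀ c : ℝ, 0 < c → ∃ lam : ℕ, 1 ≤ lam ∧ ∃ c' : ℝ, 0 < c' ∧ ∀ p : unitInterval,
      ε ≤ (p : ℝ) → (p : ℝ) ≤ 1 - ε → ∀ n : ℕ, m₀ ≤ n → c ≤ crossingProb k p (2 * n) (n - 1) →
      ∀ z : ℤ × ℤ, c' ≤ (bondPercolation (slabGraph 3 k) p).real (circuitAround k z (lam * n) (2 * (lam * n))) :=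
  h310_of_cornerGlue hk hm₀ (le_trans (by norm_num) hm₀) (cornerGlue_all hk)
    (ε₀ := 1 / (12 * ((k : ℝ) + 1))) (by positivity) (hl_smallP_uniform k)

end NTW17

end Literature.Probability.Percolation

end
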